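import Mathlib
import HarnessLib
import Summits.Langlands.Langlands.Theorems.ExteriorSquareAscentInducedSquareAscentRegroup
import Summits.Langlands.Langlands.Theorems.ExteriorSquareAscentInducedSquareAscentIdentitiesAB
import Summits.Langlands.Langlands.Theorems.ExteriorSquareAscentInducedSquareAscentStubCentralCharacterDescent
import Summits.Langlands.Langlands.Theorems.ExteriorSquareAscentInducedSquareAscentStubLocalIdentities
import Summits.Langlands.Langlands.Theorems.ExteriorSquareAscentInducedSquareAscentCoreAux
import Literature.NumberTheory.Automorphic.IsobaricRigidityRepData
import Literature.NumberTheory.Automorphic.PairLFunctionPolesRepDataHolds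
import Literature.NumberTheory.Automorphic.GaloisActionPlaces
import Literature.NumberTheory.Automorphic.KimExteriorSquareGL4Lemmas
import Literature.NumberTheory.Automorphic.KimExteriorSquareGL4Proofs
import Literature.NumberTheory.Automorphic.TunnellOctahedralGlobal
import Literature.NumberTheory.Automorphic.ArthurClozelCuspidalDescentGLOneHolds
import Literature.NumberTheory.Automorphic.AutomorphicTwistHecke
import Literature.NumberTheory.Automorphic.HeckeCharacterPairRigidity
import Literature.NumberTheory.Automorphic.RamakrishnanMultiplicityOneDihedral
import Literature.NumberTheory.Automorphic.RamakrishnanMultiplicityOneLemma414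
import Literature.NumberTheory.Automorphic.CuspidalDescentDetCubicRepData
import Literature.NumberTheory.Automorphic.ExistsClassFieldCharacterHolds
import Literature.NumberTheory.Automorphic.ClassFieldCharacterFrobenius
import Literature.NumberTheory.Automorphic.ArtinLFunctionsAbelianProofs
import Literature.NumberTheory.Automorphic.PairLFunctionPolesGLOneProofs
import Literature.NumberTheory.GaloisRepresentations.HeckeLFunctionAnalyticProofs
import Literature.NumberTheory.GaloisRepresentations.HeckeCharacter

/-!
# The duality dichotomy of the Klein-cube line (stub `stub_dualityDichotomy` of crux `InducedSquareAscent`)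

For unitary zero-free matching data `(π₀, P₀)` (the crux's exterior-square / automorphic-induction
matching), a Galois-conjugate datum `P₀^τ`, and granted Arthur–Clozel Ch. 3 (2.2), (2.3) for Borel–Jacquet
data, EITHER `π₀` is `ε_{L/K}`-self-twisted at Satake level a.e. OR (Case I)
`t_{P₀,w}⁻¹ = ω(ϖ_v)^{-f(w|v)} t_{P₀,w}` a.e. Proof: Jacquet–Shalika pole counting along `t ↦ 1 + t`,
`t → 0⁺`, in the identities (B') and (A) of `…InducedSquareAscentIdentitiesAB` (module docstrings there
and in `…CoreAux`); `ε` is the class-field character of `L/K` (`exists_isClassFieldCharacter_holds`).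
-/

set_option linter.unusedVariables false
set_option linter.dupNamespace false
set_option linter.unusedSimpArgs false

noncomputable section

namespace Summit.Langlands.Langlands.Theorems.InducedSquareAscentKleinCube

open scoped Classical NumberField Topology
open Filter IsDedekindDomain NumberField
open Literature.NumberTheory.Automorphic
open Literature.NumberTheory.GaloisRepresentations (HeckeCharacter)

/-! ### The stub -/

set_option maxHeartbeats 800000 in
/-- **STUB 6 of the Klein-cube line — the duality dichotomy (Steps A+B of the idea card: identities
(A), (B') + Jacquet–Shalika (2.2)/(2.3)).** See the module docstring for the statement and the
proof. Inputs: the landed `stub_localIdentities` (local Satake identities (1)–(4)),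
`kleinHelper_identityA`, `kleinHelper_identityB`, `kleinHelper_regroup`'s fibre lemmas, and the tree's
theorems: unitary (2.1) (`JacquetShalika1981_multipliable_partialPairL_repData_holds`), the limit
packaging `exists_tendsto_pow_mul_partialPairL_ofReal_add` / `exists_tendsto_ofReal_mul_partialPairL_dual`
(`IsobaricRigidityRepData`), central characters (`exists_heckeCharacter_prod_satake'`), base change of
Hecke characters (`eventually_valueAtUniformizer_baseChange`), the class-field character
(`exists_isClassFieldCharacter_holds`, `IsClassFieldCharacter.eventually_isPrimitiveRoot_valueAtUniformizer`,
Hecke rigidity `ext_of_eventually_valueAtUniformizer_eq`), contragredients, twists, `GL(1)` data.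
[cite: JacquetShalikaAJM1981II, Prop. 3.6 and Thm. 4.4] [cite: ArthurClozelAMS120, Ch. 3 §2 (2.1)–(2.3) and Lemma 4.3] -/
theorem stub_dualityDichotomy :
    ∀ (K L : Type) [Field K] [NumberField K] [Field L] [NumberField L] [Algebra K L] [IsGalois K L],
      Module.finrank K L = 2 → ∀ (τ : L ≃ₐ[K] L), τ ≠ 1 →
      ∀ (hcpt : isCompact_glFiniteIntegralLevel 4 K) (hL3 : isCompact_glFiniteIntegralLevel 3 L)
        (π₀ : CuspidalAutomorphicRepData 4 K hcpt) (P₀ : CuspidalAutomorphicRepData 3 L hL3),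
      JacquetShalika1981_partialPairL_boundary_repData →
      JacquetShalika1981_partialPairL_pole_repData →
      (∀ᶠ v : HeightOneSpectrum (𝓞 K) in cofinite, ∀ α : Multiset ℂ, π₀.1.HasSatakeParamAt v α →
        ‖α.prod‖ = 1 ∧ ∀ a ∈ α, a ≠ 0) →
      (∀ᶠ w : HeightOneSpectrum (𝓞 L) in cofinite, ∀ β : Multiset ℂ, P₀.1.HasSatakeParamAt w β →
        ‖β.prod‖ = 1 ∧ ∀ b ∈ β, b ≠ 0) →
      (∀ᶠ v : HeightOneSpectrum (𝓞 K) in cofinite, ∀ α : Multiset ℂ, π₀.1.HasSatakeParamAt v α →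
        ((∃ w : HeightOneSpectrum (𝓞 L), w.asIdeal.under (𝓞 K) = v.asIdeal ∧
            w.asIdeal.inertiaDeg (𝓞 K) = 1) →
          ∃ w₁ w₂ : HeightOneSpectrum (𝓞 L), w₁ ≠ w₂ ∧ w₁.asIdeal.under (𝓞 K) = v.asIdeal ∧
            w₂.asIdeal.under (𝓞 K) = v.asIdeal ∧ ∃ β₁ β₂ : Multiset ℂ,
              P₀.1.HasSatakeParamAt w₁ β₁ ∧ P₀.1.HasSatakeParamAt w₂ β₂ ∧
                (α.powersetCard 2).map Multiset.prod = β₁ + β₂) ∧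
        ((¬ ∃ w : HeightOneSpectrum (𝓞 L), w.asIdeal.under (𝓞 K) = v.asIdeal ∧
            w.asIdeal.inertiaDeg (𝓞 K) = 1) →
          ∃ w : HeightOneSpectrum (𝓞 L), w.asIdeal.under (𝓞 K) = v.asIdeal ∧
            ∃ β γ : Multiset ℂ, P₀.1.HasSatakeParamAt w β ∧ γ.map (fun c => c ^ 2) = β ∧
              (α.powersetCard 2).map Multiset.prod = γ + γ.map (fun c => -c))) →
      (∃ P' : CuspidalAutomorphicRepData 3 L hL3, ∀ᶠ w : HeightOneSpectrum (𝓞 L) in cofinite,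
        ∀ β : Multiset ℂ, P'.1.HasSatakeParamAt w β ↔ P₀.1.HasSatakeParamAt (τ • w) β) →
      (∀ᶠ v : HeightOneSpectrum (𝓞 K) in cofinite, ∀ α : Multiset ℂ, π₀.1.HasSatakeParamAt v α →
          α.map (fun a => quadraticSign L v * a) = α) ∨
      (∀ᶠ w : HeightOneSpectrum (𝓞 L) in cofinite, ∀ α β : Multiset ℂ,
        π₀.1.HasSatakeParamAt (w.under (𝓞 K)) α → P₀.1.HasSatakeParamAt w β →
          β.map (fun b => b⁻¹) = β.map (fun b => (α.prod ^ w.asIdeal.inertiaDeg (𝓞 K))⁻¹ * b)) := by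
  intro K L _ _ _ _ _ _ hdeg τ hτ hcpt hL3 π₀ P₀ h22 h23 hUπ hUP hmatch hgal
  classical
  -- dispose of the self-twisted case
  by_cases hD2 : ∀ᶠ v : HeightOneSpectrum (𝓞 K) in cofinite, ∀ α : Multiset ℂ,
      π₀.1.HasSatakeParamAt v α → α.map (fun a => quadraticSign L v * a) = α
  · exact Or.inl hD2
  right
  /- ## 0. Generalities -/
  have h1K : isCompact_glFiniteIntegralLevel 1 K := isCompact_glFiniteIntegralLevel_holds 1 K
  have h1L : isCompact_glFiniteIntegralLevel 1 L := isCompact_glFiniteIntegralLevel_holds 1 L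
  have h2prime : (Module.finrank K L).Prime := by rw [hdeg]; exact Nat.prime_two
  haveI : FiniteDimensional K L := Module.finite_of_finrank_pos (by omega)
  haveI : Fact (Nat.Prime 2) := ⟨Nat.prime_two⟩
  haveI : IsCyclic (L ≃ₐ[K] L) := isCyclic_of_prime_card (p := 2)
    (by rw [IsGalois.card_aut_eq_finrank, hdeg])
  have huπ : π₀.1.hasSatakeParamAt_unique := π₀.1.hasSatakeParamAt_unique_holds
  have huP : P₀.1.hasSatakeParamAt_unique := P₀.1.hasSatakeParamAt_unique_holds
  /- ## 1. Satake families, characters, auxiliary data -/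
  obtain ⟨α, hα⟩ := kc_exists_satakeFamily π₀.1
  obtain ⟨B, hB⟩ := kc_exists_satakeFamily P₀.1
  obtain ⟨ω, hω⟩ := exists_heckeCharacter_prod_satake' π₀
  obtain ⟨Ω, hΩ⟩ := exists_heckeCharacter_prod_satake' P₀
  obtain ⟨ε, hεcf, hεord⟩ := (exists_isClassFieldCharacter_holds (F := K) (E := L) :
    ∃ η : HeckeCharacter K, η.IsClassFieldCharacter L ∧ orderOf η = Module.finrank K L)
  rw [hdeg] at hεord
  have hεroot := hεcf.eventually_isPrimitiveRoot_valueAtUniformizer h2prime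
  have hεne : ε ≠ 1 := by
    intro h; rw [h, orderOf_one] at hεord; omega
  set ωL : HeckeCharacter L := ω.baseChange L with hωLdef
  have hωL := ω.eventually_valueAtUniformizer_baseChange (E := L)
  obtain ⟨πv, hπv⟩ := CuspidalAutomorphicRepData.exists_contragredient_satake_holds hcpt π₀
  obtain ⟨D, hD⟩ := πv.exists_twist_hecke_hasSatakeParamAt ε
  obtain ⟨oneK, honeK⟩ := exists_cuspidal_glOne_hasSatakeParamAt_one h1K
  obtain ⟨E1, hE1⟩ := exists_cuspidal_glOne_hasSatakeParamAt_valueAtUniformizer' h1K ε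
  obtain ⟨P', hP'⟩ := hgal
  have huP' : P'.1.hasSatakeParamAt_unique := P'.1.hasSatakeParamAt_unique_holds
  obtain ⟨Pv, hPv⟩ := CuspidalAutomorphicRepData.exists_contragredient_satake_holds hL3 P₀
  obtain ⟨P'v, hP'v⟩ := CuspidalAutomorphicRepData.exists_contragredient_satake_holds hL3 P'
  obtain ⟨Ta, hTa⟩ := P₀.exists_twist_hecke_hasSatakeParamAt ωL⁻¹
  obtain ⟨Tb, hTb⟩ := P'.exists_twist_hecke_hasSatakeParamAt ωL⁻¹
  obtain ⟨Tc, hTc⟩ := Pv.exists_twist_hecke_hasSatakeParamAt (Ω * ωL⁻¹)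
  obtain ⟨oneL, honeL⟩ := exists_cuspidal_glOne_hasSatakeParamAt_one h1L
  /- ## 2. The good places -/
  have hGK : ∀ᶠ v : HeightOneSpectrum (𝓞 K) in cofinite, π₀.1.HasSatakeParamAt v (α v) ∧ (∀ a : Multiset ℂ, π₀.1.HasSatakeParamAt v a → ‖a.prod‖ = 1 ∧ ∀ x ∈ a, x ≠ 0) ∧ (∀ a : Multiset ℂ, π₀.1.HasSatakeParamAt v a → ((∃ w : HeightOneSpectrum (𝓞 L), w.asIdeal.under (𝓞 K) = v.asIdeal ∧ w.asIdeal.inertiaDeg (𝓞 K) = 1) → ∃ w₁ w₂ : HeightOneSpectrum (𝓞 L), w₁ ≠ w₂ ∧ w₁.asIdeal.under (𝓞 K) = v.asIdeal ∧ w₂.asIdeal.under (𝓞 K) = v.asIdeal ∧ ∃ β₁ β₂ : Multiset ℂ, P₀.1.HasSatakeParamAt w₁ β₁ ∧ P₀.1.HasSatakeParamAt w₂ β₂ ∧ (a.powersetCard 2).map Multiset.prod = β₁ + β₂) ∧ ((¬ ∃ w : HeightOneSpectrum (𝓞 L), w.asIdeal.under (𝓞 K) = v.asIdeal ∧ w.asIdeal.inertiaDeg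 (𝓞 K) = 1) → ∃ w : HeightOneSpectrum (𝓞 L), w.asIdeal.under (𝓞 K) = v.asIdeal ∧ ∃ β γ : Multiset ℂ, P₀.1.HasSatakeParamAt w β ∧ γ.map (fun c => c ^ 2) = β ∧ (a.powersetCard 2).map Multiset.prod = γ + γ.map (fun c => -c))) ∧ (∀ a : Multiset ℂ, π₀.1.HasSatakeParamAt v a → ω.valueAtUniformizer v = a.prod) ∧ IsPrimitiveRoot (ε.valueAtUniformizer v) (v.asIdeal.inertiaDegIn (𝓞 L)) ∧ (∀ a : Multiset ℂ, πv.1.HasSatakeParamAt v a → D.1.HasSatakeParamAt v (a.map (ε.valueAtUniformizer v * ·))) ∧ oneK.1.HasSatakeParamAt v {1} ∧ E1.1.HasSatakeParamAt v {ε.valueAtUniformizer v} ∧ v.asIdeal.ramificationIdxIn (𝓞 L) = 1 := by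
    filter_upwards [hα, hUπ, hmatch, hω, hεroot, hD, honeK, hE1,
      eventually_ramificationIdxIn_eq_one (K := K) (L := L)] with v h1 h2 h3 h4 h5 h6 h7 h8 h9
    exact ⟨h1, h2, h3, h4, h5, h6, h7, h8, h9⟩
  have hGL : ∀ᶠ w : HeightOneSpectrum (𝓞 L) in cofinite, P₀.1.HasSatakeParamAt w (B w) ∧ (∀ b : Multiset ℂ, P₀.1.HasSatakeParamAt w b → ‖b.prod‖ = 1 ∧ ∀ x ∈ b, x ≠ 0) ∧ (∀ b : Multiset ℂ, P₀.1.HasSatakeParamAt w b → Ω.valueAtUniformizer w = b.prod) ∧ ωL.valueAtUniformizer w = ω.valueAtUniformizer (w.under (𝓞 K)) ^ w.asIdeal.inertiaDeg (𝓞 K) ∧ (∀ b : Multiset ℂ, P'.1.HasSatakeParamAt w b ↔ P₀.1.HasSatakeParamAt (τ • w) b) ∧ (∀ b : Multiset ℂ, P₀.1.HasSatakeParamAt w b → Ta.1.HasSatakeParamAt w (b.map ((ωL⁻¹).valueAtUniformizer w * ·))) ∧ (∀ b : Multiset ℂ, P'.1.HasSatakeParamAt w b → Tb.1.HasSatakeParamAt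 w (b.map ((ωL⁻¹).valueAtUniformizer w * ·))) ∧ (∀ b : Multiset ℂ, Pv.1.HasSatakeParamAt w b → Tc.1.HasSatakeParamAt w (b.map ((Ω * ωL⁻¹).valueAtUniformizer w * ·))) ∧ oneL.1.HasSatakeParamAt w {1} := by
    filter_upwards [hB, hUP, hΩ, hωL, hP', hTa, hTb, hTc, honeL] with w h1 h2 h3 h4 h5 h6 h7 h8 h9
    exact ⟨h1, h2, h3, h4, h5, h6, h7, h8, h9⟩
  have hGL' := ccd_eventually_forall_under_eq_under K hGL
  have hGKL := Literature.NumberTheory.Automorphic.eventually_under (F := K) (E := L) hGK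
  /- ## 3. The Jacquet–Shalika sets -/
  obtain ⟨S1, hS1f, hk1⟩ := exists_tendsto_ofReal_mul_partialPairL_dual h23 (by norm_num : 0 < 4) π₀ πv
  obtain ⟨S2, hS2f, hk2⟩ := h22 4 4 K hcpt hcpt (by norm_num) (by norm_num) π₀ D
  obtain ⟨S3, hS3f, hk3⟩ :=
    exists_tendsto_ofReal_mul_partialPairL_dual h23 (by norm_num : 0 < 1) oneK oneK
  obtain ⟨S4, hS4f, hk4⟩ := h22 1 1 K h1K h1K (by norm_num) (by norm_num) oneK E1
  obtain ⟨Ta0, hTa0f, hla⟩ := h22 3 3 L hL3 hL3 (by norm_num) (by norm_num) P₀ Ta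
  obtain ⟨Tb0, hTb0f, hlb⟩ := exists_tendsto_pow_mul_partialPairL_ofReal_add h22 h23 (by norm_num : 0 < 3) (by norm_num : 0 < 3) P₀ Tb
  obtain ⟨Tc0, hTc0f, hlc⟩ := exists_tendsto_pow_mul_partialPairL_ofReal_add h22 h23 (by norm_num : 0 < 3) (by norm_num : 0 < 1) Tc oneL
  obtain ⟨Td0, hTd0f, hld⟩ := exists_tendsto_ofReal_mul_partialPairL_dual h23 (by norm_num : 0 < 3) P₀ Pv
  obtain ⟨Te0, hTe0f, hle⟩ := exists_tendsto_pow_mul_partialPairL_ofReal_add h22 h23 (by norm_num : 0 < 3) (by norm_num : 0 < 3) P₀ P'v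
  obtain ⟨M1, hM1f, hm1⟩ := JacquetShalika1981_multipliable_partialPairL_repData_holds 4 4 K hcpt hcpt (by norm_num) (by norm_num) π₀ πv
  obtain ⟨M2, hM2f, hm2⟩ := JacquetShalika1981_multipliable_partialPairL_repData_holds 4 4 K hcpt hcpt (by norm_num) (by norm_num) π₀ D
  obtain ⟨M3, hM3f, hm3⟩ := JacquetShalika1981_multipliable_partialPairL_repData_holds 1 1 K h1K h1K (by norm_num) (by norm_num) oneK oneK
  obtain ⟨M4, hM4f, hm4⟩ := JacquetShalika1981_multipliable_partialPairL_repData_holds 1 1 K h1K h1K (by norm_num) (by norm_num) oneK E1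
  obtain ⟨M5, hM5f, hm5⟩ := JacquetShalika1981_multipliable_partialPairL_repData_holds 3 3 L hL3 hL3 (by norm_num) (by norm_num) P₀ Ta
  obtain ⟨M6, hM6f, hm6⟩ := JacquetShalika1981_multipliable_partialPairL_repData_holds 3 3 L hL3 hL3 (by norm_num) (by norm_num) P₀ Tb
  obtain ⟨M7, hM7f, hm7⟩ := JacquetShalika1981_multipliable_partialPairL_repData_holds 3 1 L hL3 h1L (by norm_num) (by norm_num) Tc oneL
  obtain ⟨M8, hM8f, hm8⟩ := JacquetShalika1981_multipliable_partialPairL_repData_holds 3 3 L hL3 hL3 (by norm_num) (by norm_num) P₀ Pv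
  obtain ⟨M9, hM9f, hm9⟩ := JacquetShalika1981_multipliable_partialPairL_repData_holds 3 3 L hL3 hL3 (by norm_num) (by norm_num) P₀ P'v
  /- ## 4. The exceptional set `S` and the set `T` of places of `L` above it -/
  obtain ⟨SK, hSKf, hSK⟩ := kc_exists_finite_forall_not_mem hGK
  obtain ⟨SL, hSLf, hSL⟩ := kc_exists_finite_forall_not_mem hGL'
  set uK : HeightOneSpectrum (𝓞 L) → HeightOneSpectrum (𝓞 K) := fun w => w.under (𝓞 K) with huK
  set SJL : Set (HeightOneSpectrum (𝓞 L)) :=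
    Ta0 ∪ Tb0 ∪ Tc0 ∪ Td0 ∪ Te0 ∪ M5 ∪ M6 ∪ M7 ∪ M8 ∪ M9 with hSJL
  have hSJLf : SJL.Finite :=
    ((((((((hTa0f.union hTb0f).union hTc0f).union hTd0f).union hTe0f).union hM5f).union hM6f).union
      hM7f).union hM8f).union hM9f
  set S : Set (HeightOneSpectrum (𝓞 K)) :=
    SK ∪ uK '' SL ∪ (S1 ∪ S2 ∪ S3 ∪ S4 ∪ M1 ∪ M2 ∪ M3 ∪ M4) ∪ uK '' SJL with hSdef
  have hSf : S.Finite :=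
    ((hSKf.union (hSLf.image _)).union
      (((((((hS1f.union hS2f).union hS3f).union hS4f).union hM1f).union hM2f).union hM3f).union
        hM4f)).union (hSJLf.image _)
  set T : Set (HeightOneSpectrum (𝓞 L)) := {w | w.under (𝓞 K) ∈ S} with hTdef
  have hTf : T.Finite := finite_setOf_under_mem hSf
  -- inclusions
  have hS1 : S1 ⊆ S := fun v hv => by simp only [hSdef, Set.mem_union, hv, true_or, or_true]
  have hS2 : S2 ⊆ S := fun v hv => by simp only [hSdef, Set.mem_union, hv, true_or, or_true]
  have hS3 : S3 ⊆ S := fun v hv => by simp only [hSdef, Set.mem_union, hv, true_or, or_true]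
  have hS4 : S4 ⊆ S := fun v hv => by simp only [hSdef, Set.mem_union, hv, true_or, or_true]
  have hM1 : M1 ⊆ S := fun v hv => by simp only [hSdef, Set.mem_union, hv, true_or, or_true]
  have hM2 : M2 ⊆ S := fun v hv => by simp only [hSdef, Set.mem_union, hv, true_or, or_true]
  have hM3 : M3 ⊆ S := fun v hv => by simp only [hSdef, Set.mem_union, hv, true_or, or_true]
  have hM4 : M4 ⊆ S := fun v hv => by simp only [hSdef, Set.mem_union, hv, true_or, or_true]
  have hTsub : ∀ X : Set (HeightOneSpectrum (𝓞 L)), X ⊆ SJL → X ⊆ T := by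
    intro X hX w hw
    simp only [hTdef, Set.mem_setOf_eq, hSdef, Set.mem_union, Set.mem_image]
    exact Or.inr ⟨w, hX hw, rfl⟩
  have hTa0 : Ta0 ⊆ T := hTsub _ (fun w hw => by simp only [hSJL, Set.mem_union, hw, true_or, or_true])
  have hTb0 : Tb0 ⊆ T := hTsub _ (fun w hw => by simp only [hSJL, Set.mem_union, hw, true_or, or_true])
  have hTc0 : Tc0 ⊆ T := hTsub _ (fun w hw => by simp only [hSJL, Set.mem_union, hw, true_or, or_true])
  have hTd0 : Td0 ⊆ T := hTsub _ (fun w hw => by simp only [hSJL, Set.mem_union, hw, true_or, or_true])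
  have hTe0 : Te0 ⊆ T := hTsub _ (fun w hw => by simp only [hSJL, Set.mem_union, hw, true_or, or_true])
  have hM5 : M5 ⊆ T := hTsub _ (fun w hw => by simp only [hSJL, Set.mem_union, hw, true_or, or_true])
  have hM6 : M6 ⊆ T := hTsub _ (fun w hw => by simp only [hSJL, Set.mem_union, hw, true_or, or_true])
  have hM7 : M7 ⊆ T := hTsub _ (fun w hw => by simp only [hSJL, Set.mem_union, hw, true_or, or_true])
  have hM8 : M8 ⊆ T := hTsub _ (fun w hw => by simp only [hSJL, Set.mem_union, hw, true_or, or_true])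
  have hM9 : M9 ⊆ T := hTsub _ (fun w hw => by simp only [hSJL, Set.mem_union, hw, true_or, or_true])
  -- good places off `S` / `T`
  have hK : ∀ v ∉ S, _ := fun v hv => hSK v (fun h => hv (by simp only [hSdef, Set.mem_union, h, true_or]))
  have hL : ∀ w : HeightOneSpectrum (𝓞 L), w.under (𝓞 K) ∉ S → ∀ u : HeightOneSpectrum (𝓞 L), u.under (𝓞 K) = w.under (𝓞 K) → _ := fun w hw => hSL w (fun h => hw (by
      simp only [hSdef, Set.mem_union, Set.mem_image]
      exact Or.inl (Or.inl (Or.inr ⟨w, h, rfl⟩))))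
  have hT_iff : ∀ w : HeightOneSpectrum (𝓞 L), w ∉ T ↔ w.under (𝓞 K) ∉ S := fun w => Iff.rfl
  /- ## 5. Pointwise facts at the good places -/
  -- `K`-side
  have sα : ∀ v ∉ S, π₀.1.HasSatakeParamAt v (α v) := fun v hv => (hK v hv).1
  have uα : ∀ v ∉ S, ‖(α v).prod‖ = 1 := fun v hv => ((hK v hv).2.1 (α v) (sα v hv)).1
  have nzα : ∀ v ∉ S, ∀ x ∈ α v, x ≠ 0 := fun v hv => ((hK v hv).2.1 (α v) (sα v hv)).2
  have cα : ∀ v ∉ S, Multiset.card (α v) = 4 := fun v hv => (sα v hv).card_eq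
  have hωv : ∀ v ∉ S, ω.valueAtUniformizer v = (α v).prod := fun v hv => (hK v hv).2.2.2.1 (α v) (sα v hv)
  have hunr : ∀ v ∉ S, v.asIdeal.ramificationIdxIn (𝓞 L) = 1 := fun v hv => (hK v hv).2.2.2.2.2.2.2.2
  -- `ε(ϖ_v) = quadraticSign L v = ±1` off `S`
  have hεv : ∀ v ∉ S, _ := fun v hv => kc_eps_values (L := L) hdeg hτ (hunr v hv) (hK v hv).2.2.2.2.1
  have hεsplit : ∀ v ∉ S, ∀ w : HeightOneSpectrum (𝓞 L), w.under (𝓞 K) = v → w.asIdeal.inertiaDeg (𝓞 K) = 1 → ε.valueAtUniformizer v = 1 := fun v hv => (hεv v hv).1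
  have hεinert : ∀ v ∉ S, ∀ w : HeightOneSpectrum (𝓞 L), w.under (𝓞 K) = v → w.asIdeal.inertiaDeg (𝓞 K) = 2 → ε.valueAtUniformizer v = -1 := fun v hv => (hεv v hv).2.1
  have hεnorm : ∀ v ∉ S, ‖ε.valueAtUniformizer v‖ = 1 := fun v hv => (hεv v hv).2.2.2.1
  -- the `K`-side families
  set αv : SatakeFamily K := fun v => (α v).map (·⁻¹) with hαv
  set fD : SatakeFamily K := fun v => ((α v).map (·⁻¹)).map (ε.valueAtUniformizer v * ·) with hfD
  set one1 : SatakeFamily K := fun _ => ({1} : Multiset ℂ) with hone1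
  set fE : SatakeFamily K := fun v => ({ε.valueAtUniformizer v} : Multiset ℂ) with hfE
  have sαv : ∀ v ∉ S, πv.1.HasSatakeParamAt v (αv v) := fun v hv => hπv v _ (sα v hv)
  have sD : ∀ v ∉ S, D.1.HasSatakeParamAt v (fD v) := fun v hv => (hK v hv).2.2.2.2.2.1 _ (sαv v hv)
  have s1 : ∀ v ∉ S, oneK.1.HasSatakeParamAt v (one1 v) := fun v hv => (hK v hv).2.2.2.2.2.2.1
  have sE : ∀ v ∉ S, E1.1.HasSatakeParamAt v (fE v) := fun v hv => (hK v hv).2.2.2.2.2.2.2.1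
  have uαv : ∀ v ∉ S, ‖(αv v).prod‖ = 1 := fun v hv => by
    simp only [hαv, Multiset.prod_map_inv', norm_inv, uα v hv, inv_one]
  have uD : ∀ v ∉ S, ‖(fD v).prod‖ = 1 := fun v hv => by
    simp only [hfD, kc_prod_map_const_mul, Multiset.prod_map_inv', norm_mul, norm_pow, norm_inv,
      hεnorm v hv, uα v hv, one_pow, inv_one, mul_one]
  have u1 : ∀ v ∉ S, ‖(one1 v).prod‖ = 1 := fun v hv => by simp [hone1]
  have uE : ∀ v ∉ S, ‖(fE v).prod‖ = 1 := fun v hv => by simp [hfE, hεnorm v hv]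
  -- `L`-side
  have hLw : ∀ w : HeightOneSpectrum (𝓞 L), w.under (𝓞 K) ∉ S → _ := fun w hw => hL w hw w rfl
  have hτunder : ∀ w : HeightOneSpectrum (𝓞 L), (τ • w).under (𝓞 K) = w.under (𝓞 K) := fun w => HeightOneSpectrum.under_algEquiv_smul K L τ w
  have hLτw : ∀ w : HeightOneSpectrum (𝓞 L), w.under (𝓞 K) ∉ S → _ := fun w hw => hL w hw (τ • w) (hτunder w)
  have sB : ∀ w : HeightOneSpectrum (𝓞 L), w.under (𝓞 K) ∉ S → P₀.1.HasSatakeParamAt w (B w) := fun w hw => (hLw w hw).1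
  have sBτ : ∀ w : HeightOneSpectrum (𝓞 L), w.under (𝓞 K) ∉ S → P₀.1.HasSatakeParamAt (τ • w) (B (τ • w)) := fun w hw => (hLτw w hw).1
  have uB : ∀ w : HeightOneSpectrum (𝓞 L), w.under (𝓞 K) ∉ S → ‖(B w).prod‖ = 1 := fun w hw => ((hLw w hw).2.1 _ (sB w hw)).1
  have uBτ : ∀ w : HeightOneSpectrum (𝓞 L), w.under (𝓞 K) ∉ S → ‖(B (τ • w)).prod‖ = 1 := fun w hw => ((hLτw w hw).2.1 _ (sBτ w hw)).1
  have nzB : ∀ w : HeightOneSpectrum (𝓞 L), w.under (𝓞 K) ∉ S → ∀ x ∈ B w, x ≠ 0 := fun w hw => ((hLw w hw).2.1 _ (sB w hw)).2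
  have cB : ∀ w : HeightOneSpectrum (𝓞 L), w.under (𝓞 K) ∉ S → Multiset.card (B w) = 3 := fun w hw => (sB w hw).card_eq
  have cBτ : ∀ w : HeightOneSpectrum (𝓞 L), w.under (𝓞 K) ∉ S → Multiset.card (B (τ • w)) = 3 := fun w hw => (sBτ w hw).card_eq
  have hΩw : ∀ w : HeightOneSpectrum (𝓞 L), w.under (𝓞 K) ∉ S → Ω.valueAtUniformizer w = (B w).prod := fun w hw => (hLw w hw).2.2.1 _ (sB w hw)
  have hωLw : ∀ w : HeightOneSpectrum (𝓞 L), w.under (𝓞 K) ∉ S → ωL.valueAtUniformizer w = (α (w.under (𝓞 K))).prod ^ w.asIdeal.inertiaDeg (𝓞 K) := fun w hw => by rw [(hLw w hw).2.2.2.1, hωv _ hw]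
  have nωL : ∀ w : HeightOneSpectrum (𝓞 L), w.under (𝓞 K) ∉ S → ‖ωL.valueAtUniformizer w‖ = 1 := fun w hw => by rw [hωLw w hw, norm_pow, uα _ hw, one_pow]
  have nzωL : ∀ w : HeightOneSpectrum (𝓞 L), w.under (𝓞 K) ∉ S → ωL.valueAtUniformizer w ≠ 0 := fun w hw h0 => by have := nωL w hw; rw [h0, norm_zero] at this; exact zero_ne_one this
  have nΩ : ∀ w : HeightOneSpectrum (𝓞 L), w.under (𝓞 K) ∉ S → ‖Ω.valueAtUniformizer w‖ = 1 := fun w hw => by rw [hΩw w hw, uB w hw]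
  have sP' : ∀ w : HeightOneSpectrum (𝓞 L), w.under (𝓞 K) ∉ S → P'.1.HasSatakeParamAt w (B (τ • w)) := fun w hw => ((hLw w hw).2.2.2.2.1 _).mpr (sBτ w hw)
  -- the `L`-side families
  set fTa : SatakeFamily L := fun w => (B w).map ((ωL.valueAtUniformizer w)⁻¹ * ·) with hfTa
  set fTb : SatakeFamily L := fun w => (B (τ • w)).map ((ωL.valueAtUniformizer w)⁻¹ * ·) with hfTb
  set fTc : SatakeFamily L := fun w =>
    ((B w).map (·⁻¹)).map ((Ω.valueAtUniformizer w * (ωL.valueAtUniformizer w)⁻¹) * ·) with hfTc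
  set fPv : SatakeFamily L := fun w => (B w).map (·⁻¹) with hfPv
  set fP'v : SatakeFamily L := fun w => (B (τ • w)).map (·⁻¹) with hfP'v
  set oneL1 : SatakeFamily L := fun _ => ({1} : Multiset ℂ) with honeL1
  have hinvval : ∀ w : HeightOneSpectrum (𝓞 L), (ωL⁻¹).valueAtUniformizer w = (ωL.valueAtUniformizer w)⁻¹ := fun w => HeckeCharacter.valueAtUniformizer_inv ωL w
  have hmulval : ∀ w : HeightOneSpectrum (𝓞 L), (Ω * ωL⁻¹).valueAtUniformizer w = Ω.valueAtUniformizer w * (ωL.valueAtUniformizer w)⁻¹ := fun w => by rw [HeckeCharacter.valueAtUniformizer_mul, hinvval]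
  have sTa : ∀ w ∉ T, Ta.1.HasSatakeParamAt w (fTa w) := fun w hw => by
    have h := (hLw w hw).2.2.2.2.2.1 _ (sB w hw)
    rwa [hinvval] at h
  have sTb : ∀ w ∉ T, Tb.1.HasSatakeParamAt w (fTb w) := fun w hw => by
    have h := (hLw w hw).2.2.2.2.2.2.1 _ (sP' w hw)
    rwa [hinvval] at h
  have sPv : ∀ w ∉ T, Pv.1.HasSatakeParamAt w (fPv w) := fun w hw => hPv w _ (sB w hw)
  have sTc : ∀ w ∉ T, Tc.1.HasSatakeParamAt w (fTc w) := fun w hw => by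
    have h := (hLw w hw).2.2.2.2.2.2.2.1 _ (sPv w hw)
    rwa [hmulval] at h
  have sP'v : ∀ w ∉ T, P'v.1.HasSatakeParamAt w (fP'v w) := fun w hw => hP'v w _ (sP' w hw)
  have s1L : ∀ w ∉ T, oneL.1.HasSatakeParamAt w (oneL1 w) := fun w hw => (hLw w hw).2.2.2.2.2.2.2.2
  have sBT : ∀ w ∉ T, P₀.1.HasSatakeParamAt w (B w) := fun w hw => sB w hw
  have uBT : ∀ w ∉ T, ‖(B w).prod‖ = 1 := fun w hw => uB w hw
  have uTa : ∀ w ∉ T, ‖(fTa w).prod‖ = 1 := fun w hw => by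
    simp only [hfTa, kc_prod_map_const_mul, norm_mul, norm_pow, norm_inv, nωL w hw, uB w hw, inv_one,
      one_pow, mul_one]
  have uTb : ∀ w ∉ T, ‖(fTb w).prod‖ = 1 := fun w hw => by
    simp only [hfTb, kc_prod_map_const_mul, norm_mul, norm_pow, norm_inv, nωL w hw, uBτ w hw, inv_one,
      one_pow, mul_one]
  have uTc : ∀ w ∉ T, ‖(fTc w).prod‖ = 1 := fun w hw => by
    simp only [hfTc, kc_prod_map_const_mul, Multiset.prod_map_inv', norm_mul, norm_pow, norm_inv,
      nωL w hw, nΩ w hw, uB w hw, inv_one, one_pow, mul_one]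
  have uPv : ∀ w ∉ T, ‖(fPv w).prod‖ = 1 := fun w hw => by
    simp only [hfPv, Multiset.prod_map_inv', norm_inv, uB w hw, inv_one]
  have uP'v : ∀ w ∉ T, ‖(fP'v w).prod‖ = 1 := fun w hw => by
    simp only [hfP'v, Multiset.prod_map_inv', norm_inv, uBτ w hw, inv_one]
  have u1L : ∀ w ∉ T, ‖(oneL1 w).prod‖ = 1 := fun w hw => by simp [honeL1]
  /- ## 6. Case I from the pole of `L^T(P₀ × P₀⊗ω_L⁻¹)`; otherwise derive a contradiction -/
  by_cases hXa : (3 = 3 ∧ ∀ᶠ w : HeightOneSpectrum (𝓞 L) in cofinite,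
      (B w).map ((((w.residueCard : ℂ) ^ (1 - (1 : ℂ)))) * ·) = (fTa w).map (·⁻¹))
  · -- Case I
    filter_upwards [hXa.2, hGL, hGKL] with w hx hgl hgk
    intro a b ha hb
    have hv := hgk (w.under (𝓞 K)) rfl
    have hbB : b = B w := huP hb hgl.1
    have haA : a = α (w.under (𝓞 K)) := huπ ha hv.1
    have hωL1 : ωL.valueAtUniformizer w = (a.prod) ^ w.asIdeal.inertiaDeg (𝓞 K) := by
      rw [hgl.2.2.2.1, hv.2.2.2.1 a ha]
    have hx' : B w = ((B w).map ((ωL.valueAtUniformizer w)⁻¹ * ·)).map (·⁻¹) := by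
      simpa only [sub_self, Complex.cpow_zero, one_mul, Multiset.map_id', hfTa] using hx
    rw [hbB, ← hωL1]
    conv_lhs => rw [hx']
    simp only [Multiset.map_map, Function.comp_def, inv_inv]
  exfalso
  /- ## 7. Limits as `t → 0⁺` along `s = 1 + t` -/
  have hz1 : (1 : ℝ) ≤ (1 : ℂ).re := by simp
  -- (k1) `t · L^S(π₀ × π₀^∨) → c₁ ≠ 0`
  obtain ⟨c1, hc1, T1⟩ := hk1 hSf hS1 sα sαv uα uαv (fun v hv => rfl)
  -- (k2) `L^S(π₀ × π₀^∨⊗ε) → c₂ ≠ 0` (no pole: `π₀` is not `ε`-self-twisted)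
  have hGX : ∀ᶠ v : HeightOneSpectrum (𝓞 K) in cofinite, π₀.1.HasSatakeParamAt v (α v) ∧ IsPrimitiveRoot (ε.valueAtUniformizer v) (v.asIdeal.inertiaDegIn (𝓞 L)) ∧ v.asIdeal.ramificationIdxIn (𝓞 L) = 1 :=
    hGK.mono fun v hv => ⟨hv.1, hv.2.2.2.2.1, hv.2.2.2.2.2.2.2.2⟩
  have hX2 : ¬ (4 = 4 ∧ ∀ᶠ v : HeightOneSpectrum (𝓞 K) in cofinite, (α v).map ((((v.residueCard : ℂ) ^ (1 - (1 : ℂ)))) * ·) = (fD v).map (·⁻¹)) := fun ⟨_, hX⟩ => hD2 (kc_selfTwist_of_X hdeg hτ huπ hGX hX)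
  obtain ⟨c2, hc2, T2'⟩ := hk2 hSf hS2 sα sD uα uD Complex.one_re hX2
  have T2 : Tendsto (fun t : ℝ => partialPairL S α fD (1 + t)) (𝓝[>] (0 : ℝ)) (𝓝 c2) :=
    T2'.comp (tendsto_ofReal_add_nhdsWithin hz1)
  -- (k3) `t · ζ_K^S → c₃ ≠ 0`
  obtain ⟨c3, hc3, T3⟩ := hk3 hSf hS3 s1 s1 u1 u1 (fun v hv => by simp [hone1])
  -- (k4) `L^S(ε) → c₄ ≠ 0` (`ε ≠ 1`, Hecke rigidity)
  have hX4 : ¬ (1 = 1 ∧ ∀ᶠ v : HeightOneSpectrum (𝓞 K) in cofinite, (one1 v).map ((((v.residueCard : ℂ) ^ (1 - (1 : ℂ)))) * ·) = (fE v).map (·⁻¹)) :=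
    kc_not_X_of_ne_one hεne
  obtain ⟨c4, hc4, T4'⟩ := hk4 hSf hS4 s1 sE u1 uE Complex.one_re hX4
  have T4 : Tendsto (fun t : ℝ => partialPairL S one1 fE (1 + t)) (𝓝[>] (0 : ℝ)) (𝓝 c4) :=
    T4'.comp (tendsto_ofReal_add_nhdsWithin hz1)
  -- (la) `L^T(P₀ × P₀⊗ω_L⁻¹) → c₅ ≠ 0` (we are off `X_a`)
  obtain ⟨c5, hc5, T5'⟩ := hla hTf hTa0 sBT sTa uBT uTa Complex.one_re hXa
  have T5 : Tendsto (fun t : ℝ => partialPairL T B fTa (1 + t)) (𝓝[>] (0 : ℝ)) (𝓝 c5) :=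
    T5'.comp (tendsto_ofReal_add_nhdsWithin hz1)
  -- (lb) `t^{e_b} L^T(P₀ × P₀^τ⊗ω_L⁻¹) → c₆ ≠ 0`
  obtain ⟨eb, c6, hc6, -, T6⟩ := hlb hTf hTb0 sBT sTb uBT uTb hz1
  -- (lc) `L^T(P₀^∨⊗Ωω_L⁻¹ × 1) → c₇ ≠ 0` (ranks `3 ≠ 1`)
  obtain ⟨ec, c7, hc7, hec, T7⟩ := hlc hTf hTc0 sTc s1L uTc u1L hz1
  have hec0 : ec = 0 := hec (by norm_num)
  rw [hec0] at T7
  simp only [pow_zero, one_mul] at T7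
  -- (ld) `t · L^T(P₀ × P₀^∨) → c₈ ≠ 0`
  obtain ⟨c8, hc8, T8⟩ := hld hTf hTd0 sBT sPv uBT uPv (fun w hw => rfl)
  -- (le) `t^{e_e} L^T(P₀ × P₀^{τ∨}) → c₉ ≠ 0`
  obtain ⟨ee, c9, hc9, -, T9⟩ := hle hTf hTe0 sBT sP'v uBT uP'v hz1
  /- ## 8. The identities (B') and (A) along `s = 1 + t`, `t > 0` -/
  have hre : ∀ t : ℝ, 0 < t → 1 < (1 + (t : ℂ)).re := fun t ht => by simp; linarith
  have hre0 : ∀ t : ℝ, 0 < t → 0 < (1 + (t : ℂ)).re := fun t ht => by simp; linarith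
  obtain ⟨LI1, LI2, LI3, LI4, -, -⟩ := stub_localIdentities
  -- local matching data in family form
  have hαcard : ∀ v ∉ S, Multiset.card (α v) = 4 ∧ ∀ a ∈ α v, a ≠ 0 := fun v hv => ⟨cα v hv, nzα v hv⟩
  have hMF : ∀ v ∉ S, _ := fun v hv =>
    kc_matching_families hdeg hτ huP sB hv (hunr v hv) ((hK v hv).2.2.1 (α v) (sα v hv))
  have hsplitF : ∀ v ∉ S, ∀ w : HeightOneSpectrum (𝓞 L), w.under (𝓞 K) = v → w.asIdeal.inertiaDeg (𝓞 K) = 1 → wedgeTwoParams (α v) = B w + B (τ • w) := fun v hv => (hMF v hv).1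
  have hinertF : ∀ v ∉ S, ∀ w : HeightOneSpectrum (𝓞 L), w.under (𝓞 K) = v → w.asIdeal.inertiaDeg (𝓞 K) = 2 → ∃ γ : Multiset ℂ, Multiset.card γ = 3 ∧ γ.map (· ^ 2) = B w ∧ wedgeTwoParams (α v) = γ + γ.map (-·) :=
    fun v hv => (hMF v hv).2
  have hsplitB : ∀ v ∉ S, ∀ w : HeightOneSpectrum (𝓞 L), w.under (𝓞 K) = v → w.asIdeal.inertiaDeg (𝓞 K) = 1 → (fun v => ε.valueAtUniformizer v) v = 1 ∧ wedgeTwoParams (α v) = B w + B (τ • w) :=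
    fun v hv w hw hf => ⟨hεsplit v hv w hw hf, hsplitF v hv w hw hf⟩
  have hinertB : ∀ v ∉ S, ∀ w : HeightOneSpectrum (𝓞 L), w.under (𝓞 K) = v → w.asIdeal.inertiaDeg (𝓞 K) = 2 → (fun v => ε.valueAtUniformizer v) v = -1 ∧ ∃ γ : Multiset ℂ, Multiset.card γ = 3 ∧ γ.map (· ^ 2) = B w ∧ wedgeTwoParams (α v) = γ + γ.map (-·) :=
    fun v hv w hw hf => ⟨hεinert v hv w hw hf, hinertF v hv w hw hf⟩
  have hBcard : ∀ w : HeightOneSpectrum (𝓞 L), w.under (𝓞 K) ∉ S → Multiset.card (B w) = 3 := cB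
  have hωLfun : ∀ w : HeightOneSpectrum (𝓞 L), w.under (𝓞 K) ∉ S → (fun w => ωL.valueAtUniformizer w) w = (α (w.under (𝓞 K))).prod ^ w.asIdeal.inertiaDeg (𝓞 K) := hωLw
  have hΩfun : ∀ w : HeightOneSpectrum (𝓞 L), w.under (𝓞 K) ∉ S → (fun w => Ω.valueAtUniformizer w) w = (B w).prod := hΩw
  -- (B') at `s = 1 + t`
  have hIdB : ∀ t : ℝ, 0 < t → partialPairL S α αv (1 + t) * partialPairL S α fD (1 + t) = partialPairL S one1 one1 (1 + t) * partialPairL S one1 fE (1 + t) * (partialPairL T fTc oneL1 (1 + t)) ^ 2 * partialPairL T B fTb (1 + t) := by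
    intro t ht
    exact kleinHelper_identityB K L hdeg τ hτ LI1 LI2 S α B (fun v => ε.valueAtUniformizer v)
      (fun w => ωL.valueAtUniformizer w) (fun w => Ω.valueAtUniformizer w) hunr hαcard hBcard hωLfun
      hΩfun hsplitB hinertB (1 + t) (hre0 t ht)
      (hm1 hSf hM1 sα sαv uα uαv (hre t ht)) (hm2 hSf hM2 sα sD uα uD (hre t ht))
      (hm3 hSf hM3 s1 s1 u1 u1 (hre t ht)) (hm4 hSf hM4 s1 sE u1 uE (hre t ht))
      (hm7 hTf hM7 sTc s1L uTc u1L (hre t ht)) (hm6 hTf hM6 sBT sTb uBT uTb (hre t ht))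
  -- (A) at `s = 1 + t`
  have hIdA : ∀ t : ℝ, 0 < t → partialPairL T B fTa (1 + t) * partialPairL T B fTb (1 + t) = partialPairL T B fPv (1 + t) * partialPairL T B fP'v (1 + t) := by
    intro t ht
    exact kleinHelper_identityA K L hdeg τ hτ LI3 LI4 S α B (fun w => ωL.valueAtUniformizer w) hunr
      hαcard hBcard hωLfun hsplitF hinertF (1 + t)
      (hm5 hTf hM5 sBT sTa uBT uTa (hre t ht)) (hm6 hTf hM6 sBT sTb uBT uTb (hre t ht))
      (hm8 hTf hM8 sBT sPv uBT uPv (hre t ht)) (hm9 hTf hM9 sBT sP'v uBT uP'v (hre t ht))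
  /- ## 9. Pole counting -/
  obtain ⟨PC1, PC2, -⟩ := kleinHelper_poleCounting
  have heb : eb = 0 := PC1 (fun t => partialPairL S α αv (1 + t)) (fun t => partialPairL S α fD (1 + t))
    (fun t => partialPairL S one1 one1 (1 + t)) (fun t => partialPairL S one1 fE (1 + t))
    (fun t => partialPairL T fTc oneL1 (1 + t)) (fun t => partialPairL T B fTb (1 + t))
    c1 c2 c3 c4 c6 c7 eb hc1 hc2 hc3 hc4 hc6 hc7 T1 T2 T3 T4 T7 T6 hIdB
  rw [heb] at T6
  simp only [pow_zero, one_mul] at T6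
  exact PC2 (fun t => partialPairL T B fTa (1 + t)) (fun t => partialPairL T B fTb (1 + t))
    (fun t => partialPairL T B fPv (1 + t)) (fun t => partialPairL T B fP'v (1 + t))
    c5 c6 c8 c9 ee hc8 hc9 T5 T6 T8 T9 hIdA

end Summit.Langlands.Langlands.Theorems.InducedSquareAscentKleinCube

end
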